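import Summits.ResolutionOfSingularities.ResolutionOfSingularities.Theorems.RadicialJungCleanModelsLogContentIdealValued
import Summits.ResolutionOfSingularities.ResolutionOfSingularities.Theorems.RadicialJungCleanModelsGiraudCoprincipalPart
import Literature.AlgebraicGeometry.Resolution.DerivativeIdealsLocalization
import HarnessLib

/-!
# Route `RadicialJung`, crux `CleanModels` (stmt-15917): LOCALISATION of the derivation-form log-Jacobian
# ideal along a chart with dual derivations — brick B3 / FILE 4 (step (S2) of `L/res-L1-s42-pv-2/w81-B3/B3-PLAN.md`)

Support file (OURS) for PROGRAMME-clean-dim2 / T2 (`HOME/L/res-L0-w81-pv-2/g5/T2-ARCHITECTURE.md`, brick **B3**);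
seat res-L1-s42-pv-2 g7 (res-plan-2 IDLE POOL DEAL #50 (2)); line `via-clean-models` of the crux `DescentPerfectToAll`
(stmt-0549).  Nothing here is a statement of Hironaka's manuscript.  AI-written; AI review weaker than expert review.

The colength `c(X, f, ξ)` (Giraud 1983, 2.2) is defined on the STALK through `logDerivJacobianIdeal (𝒪_ξ) f` — the
values `D f` of ALL derivations of `𝒪_ξ` preserving the critical primes (p557089, derivation form).  To see that it
vanishes at all but finitely many points of a chart `U = Spec A` (B3) one compares it with ONE ideal of `A`:
`J_A := span{D f : D ∈ Der_ℤ(A), x_j ∣ D x_j}` for global boundary equations `x_j` of `E(f) ∩ U`.  This file proves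
the comparison for any localization `S = M⁻¹A` (in particular `S = A_𝔭 ≅ 𝒪_{X,ξ}`):

* `span_logDerivation_map_eq_of_isLocalization` — **`J(S, f; log x) = J_A · S`**: «⊆» is res-L0-w81-pv-2's MASTER
  LEMMA `span_logDerivation_restrict_le_map` (p556431; needs `Ω[A⁄ℤ]` projective and DUAL derivations `∂_i x_j = δ_ij`
  on `A`), «⊇» extends a logarithmic derivation of `A` to `S` (`exists_derivation_extend_of_isLocalization`).
* `derivJacobianIdeal_eq_map_of_isLocalization` — the same for `J(S, f)` (no boundary: `r = 0`), i.e.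
  `derivJacobianIdeal S f = (span{D f : D ∈ Der(A)})·S` — the tool for reading `E(f)` on the chart.
* `logDerivJacobianIdeal_eq_span_of_criticalPrimes` — if the critical primes of `S` at `f` are EXACTLY the `(x_j)S`
  with `x_j` a non-unit of `S` (the geometric input «`E(f) ∩ U = V(x₁⋯x_r) ∩ U`», hypothesis `hcrit`), then the
  stalk-intrinsic `logDerivJacobianIdeal S f` IS `J(S, f; log x)` (a derivation preserves the prime `(x)` iff
  `x ∣ D x`; units impose nothing);
* hence **`logDerivJacobianIdeal_eq_map`**: `logDerivJacobianIdeal S f = J_A · S`, and with FILE 1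
  **`giraudColength_eq_zero_of_isPrincipal_map`**: if `J_A · A_𝔭` is principal then `c = 0` at `𝔭` — which FILE 3
  (`finite_setOf_not_isPrincipal_map_atPrime`) grants at all but finitely many `𝔭` of a two-dimensional chart.
What remains of B3 after this file: the chart construction (S1) discharging `hcrit` and the projectivity / dual
derivations, and the stalk transport (S4).
-/

noncomputable section

set_option linter.dupNamespace false -- mandated namespace of this single-conjunct summit

open Literature.AlgebraicGeometry.Resolution

namespace Summit.ResolutionOfSingularities.ResolutionOfSingularities.Theorems.RadicialJung.CleanModels

universe u v

section Localization

variable {A : Type u} [CommRing A] {r : ℕ} {x : Fin r → A} {δ : Fin r → Derivation ℤ A A}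
  (S : Type v) [CommRing S] [Algebra A S]

/-- **`J(S, f; log x) ⊇ J_A · S`**: a derivation of `A` logarithmic along `x` extends to a derivation of the
localization `S`, logarithmic along the images (no projectivity needed). -/
theorem map_span_logDerivation_le_of_isLocalization (M : Submonoid A) [IsLocalization M S] (f : A) :
    (Ideal.span {v : A | ∃ D : Derivation ℤ A A, (∀ j, x j ∣ D (x j)) ∧ D f = v}).map (algebraMap A S) ≤
      Ideal.span {w : S | ∃ D : Derivation ℤ S S,
        (∀ j, algebraMap A S (x j) ∣ D (algebraMap A S (x j))) ∧ D (algebraMap A S f) = w} := by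
  rw [Ideal.map_le_iff_le_comap, Ideal.span_le]
  rintro _ ⟨D, hlog, rfl⟩
  obtain ⟨D', hD'⟩ := exists_derivation_extend_of_isLocalization ℤ S M D
  rw [SetLike.mem_coe, Ideal.mem_comap, ← hD' f]
  refine Ideal.subset_span ⟨D', fun j => ?_, rfl⟩
  obtain ⟨c, hc⟩ := hlog j
  exact ⟨algebraMap A S c, by rw [hD', hc, map_mul]⟩

/-- **LOCALISATION OF THE LOG-CONTENT IDEAL: `J(S, f; log x) = J_A · S`** for a localization `S` of a ring `A`
with `Ω[A⁄ℤ]` projective and dual derivations `∂_i x_j = δ_ij` (master lemma p556431 for «⊆»). -/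
theorem span_logDerivation_map_eq_of_isLocalization (M : Submonoid A) [IsLocalization M S]
    [Module.Projective A Ω[A⁄ℤ]] (hδ : ∀ i j, δ i (x j) = if i = j then 1 else 0) (f : A) :
    Ideal.span {w : S | ∃ D : Derivation ℤ S S,
        (∀ j, algebraMap A S (x j) ∣ D (algebraMap A S (x j))) ∧ D (algebraMap A S f) = w} =
      (Ideal.span {v : A | ∃ D : Derivation ℤ A A, (∀ j, x j ∣ D (x j)) ∧ D f = v}).map (algebraMap A S) :=
  le_antisymm (span_logDerivation_restrict_le_map hδ f) (map_span_logDerivation_le_of_isLocalization S M f)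

/-- **LOCALISATION OF `J(X, f)`: `derivJacobianIdeal S f = J(A, f) · S`** for a localization `S` of a ring `A` with
`Ω[A⁄ℤ]` projective (the boundary-free case of the master lemma; no dual derivations needed). -/
theorem derivJacobianIdeal_eq_map_of_isLocalization (M : Submonoid A) [IsLocalization M S]
    [Module.Projective A Ω[A⁄ℤ]] (f : A) :
    derivJacobianIdeal S (algebraMap A S f) = (derivJacobianIdeal A f).map (algebraMap A S) := by
  have hδ : ∀ i j : Fin 0, (Fin.elim0 i : Derivation ℤ A A) ((Fin.elim0 j : A)) = if i = j then 1 else 0 :=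
    fun i => Fin.elim0 i
  have h := span_logDerivation_map_eq_of_isLocalization S (x := Fin.elim0) (δ := Fin.elim0) M hδ f
  simp only [IsEmpty.forall_iff, true_and] at h
  unfold derivJacobianIdeal
  have e1 : (Set.range fun D : Derivation ℤ S S => D (algebraMap A S f)) =
      {w | ∃ D : Derivation ℤ S S, D (algebraMap A S f) = w} := rfl
  have e2 : (Set.range fun D : Derivation ℤ A A => D f) = {v | ∃ D : Derivation ℤ A A, D f = v} := rfl
  rw [e1, e2]
  exact h

end Localization

/-! ## From the critical primes to the boundary equations -/

section CriticalPrimes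

variable {A : Type u} [CommRing A] {r : ℕ} {x : Fin r → A} (S : Type v) [CommRing S] [Algebra A S]

/-- A derivation preserves the principal ideal `(y)` iff `y ∣ D y`. -/
theorem derivation_preserves_span_singleton_iff (D : Derivation ℤ S S) (y : S) :
    (∀ a ∈ Ideal.span ({y} : Set S), D a ∈ Ideal.span ({y} : Set S)) ↔ y ∣ D y := by
  constructor
  · intro h
    exact Ideal.mem_span_singleton.mp (h y (Ideal.mem_span_singleton_self y))
  · intro hy a ha
    obtain ⟨b, rfl⟩ := Ideal.mem_span_singleton'.mp ha
    rw [Derivation.leibniz, Ideal.mem_span_singleton]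
    rw [smul_eq_mul, smul_eq_mul]
    exact dvd_add (dvd_mul_of_dvd_right hy _) (dvd_mul_right _ _)

/-- **If the critical primes are exactly the `(x_j)S` for the non-units `x_j`, the stalk-intrinsic log-Jacobian
ideal is the log span along `x`** (units impose no condition). -/
theorem logDerivJacobianIdeal_eq_span_of_criticalPrimes (g : S)
    (hcrit : ∀ P : Ideal S, P ∈ derivCriticalPrimes S g ↔
      ∃ j, ¬ IsUnit (algebraMap A S (x j)) ∧ P = Ideal.span {algebraMap A S (x j)}) :
    logDerivJacobianIdeal S g = Ideal.span {w : S | ∃ D : Derivation ℤ S S,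
      (∀ j, algebraMap A S (x j) ∣ D (algebraMap A S (x j))) ∧ D g = w} := by
  unfold logDerivJacobianIdeal
  congr 1
  ext w
  simp only [Set.mem_setOf_eq]
  constructor
  · rintro ⟨D, hD, rfl⟩
    refine ⟨D, fun j => ?_, rfl⟩
    by_cases hu : IsUnit (algebraMap A S (x j))
    · exact hu.dvd
    · have hP : Ideal.span {algebraMap A S (x j)} ∈ derivCriticalPrimes S g := (hcrit _).mpr ⟨j, hu, rfl⟩
      exact (derivation_preserves_span_singleton_iff S D _).mp (hD _ hP)
  · rintro ⟨D, hD, rfl⟩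
    refine ⟨D, fun P hP => ?_, rfl⟩
    obtain ⟨j, -, rfl⟩ := (hcrit P).mp hP
    exact (derivation_preserves_span_singleton_iff S D _).mpr (hD j)

variable {δ : Fin r → Derivation ℤ A A}

/-- **`logDerivJacobianIdeal (A_𝔭) f = J_A · A_𝔭`** on a chart with projective `Ω[A⁄ℤ]`, dual derivations and boundary
equations `x` cutting out exactly the critical primes of the localization. -/
theorem logDerivJacobianIdeal_eq_map (M : Submonoid A) [IsLocalization M S] [Module.Projective A Ω[A⁄ℤ]]
    (hδ : ∀ i j, δ i (x j) = if i = j then 1 else 0) (f : A)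
    (hcrit : ∀ P : Ideal S, P ∈ derivCriticalPrimes S (algebraMap A S f) ↔
      ∃ j, ¬ IsUnit (algebraMap A S (x j)) ∧ P = Ideal.span {algebraMap A S (x j)}) :
    logDerivJacobianIdeal S (algebraMap A S f) =
      (Ideal.span {v : A | ∃ D : Derivation ℤ A A, (∀ j, x j ∣ D (x j)) ∧ D f = v}).map (algebraMap A S) := by
  rw [logDerivJacobianIdeal_eq_span_of_criticalPrimes S _ hcrit, span_logDerivation_map_eq_of_isLocalization S M hδ f]

/-- **`c = 0` where `J_A · A_𝔭` is principal** (FILE 1: a principal ideal contains its principal hull, so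
`D(J) = ⊤`). -/
theorem giraudColength_eq_zero_of_isPrincipal_map (M : Submonoid A) [IsLocalization M S]
    [Module.Projective A Ω[A⁄ℤ]] (hδ : ∀ i j, δ i (x j) = if i = j then 1 else 0) (f : A)
    (hcrit : ∀ P : Ideal S, P ∈ derivCriticalPrimes S (algebraMap A S f) ↔
      ∃ j, ¬ IsUnit (algebraMap A S (x j)) ∧ P = Ideal.span {algebraMap A S (x j)})
    (hprinc : ((Ideal.span {v : A | ∃ D : Derivation ℤ A A, (∀ j, x j ∣ D (x j)) ∧ D f = v}).map
      (algebraMap A S)).IsPrincipal) :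
    giraudColength S (algebraMap A S f) = 0 := by
  rw [giraudColength_eq_zero_iff_principalHullIdeal_le, logDerivJacobianIdeal_eq_map S M hδ f hcrit]
  exact principalHullIdeal_le hprinc le_rfl

end CriticalPrimes

/-- **A principal log-Jacobian ideal has colength zero** (any ring). -/
theorem giraudColength_eq_zero_of_isPrincipal {O : Type u} [CommRing O] (f : O)
    (h : (logDerivJacobianIdeal O f).IsPrincipal) : giraudColength O f = 0 := by
  rw [giraudColength_eq_zero_iff_principalHullIdeal_le]
  exact principalHullIdeal_le h le_rfl

end Summit.ResolutionOfSingularities.ResolutionOfSingularities.Theorems.RadicialJung.CleanModels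

end
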